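/-
Origin: expansion seat `prover-pub-hodgecm-mc-binder-1-g17-0`, handover #R122 2026-08-20T21:53:34Z md5 262caa2e11f3 (341 l.; NEW additive MODEL leaf, ns HodgeCM.Model.LevelDeckTransfer; imports #R121 HodgeCM.Model.LevelPullInjective + PKG HodgeCM.Model.TowerInjective (#R110, for Level.finiteIndex_subgroupOf only) + Vendored SingularHomology.FiniteDeckTransferPullback; install after #R121; drop-alone below it; NAMES for audit: HodgeCM.Model.LevelDeckTransfer.exists_trPull_one_eq_of_invariant_free · HodgeCM.Model.LevelDeckTransfer.finiteDeckCover · HodgeCM.Model.LevelDeckTransfer.unif_glι_mulVec_of_mem; NAME LIST: HodgeCM.Model.LevelDeckTransfer.exists_trPull_one_eq_of_invariant_free · HodgeCM.Model.LevelDeckTransfer.finiteDeckCover · HodgeCM.Model.LevelDeckTransfer.unif_glι_mulVec_of_mem; all decls: HodgeCM.Model.LevelDeckTransfer.transCond_of_normal · HodgeCM.Model.LevelDeckTransfer.glι_mulVec_mem_cone · HodgeCM.Model.LevelDeckTransfer.unif_glι_mulVec_of_mem · HodgeCM.Model.LevelDeckTransfer.exists_mem_Γ_of_unif_eq · HodgeCM.Model.LevelDeckTransfer.deckMap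 · HodgeCM.Model.LevelDeckTransfer.deckMap_apply · HodgeCM.Model.LevelDeckTransfer.continuous_deckMap · HodgeCM.Model.LevelDeckTransfer.deckMap_unif · HodgeCM.Model.LevelDeckTransfer.deckMap_one · HodgeCM.Model.LevelDeckTransfer.deckMap_mul · HodgeCM.Model.LevelDeckTransfer.deckMap_of_mem · HodgeCM.Model.LevelDeckTransfer.deckPerm · HodgeCM.Model.LevelDeckTransfer.deckHom · HodgeCM.Model.LevelDeckTransfer.deckHom_apply · HodgeCM.Model.LevelDeckTransfer.subgroupOf_le_ker · HodgeCM.Model.LevelDeckTransfer.deckHomQuot · HodgeCM.Model.LevelDeckTransfer.deckHomQuot_mk · HodgeCM.Model.LevelDeckTransfer.deckAction · HodgeCM.Model.LevelDeckTransfer.deckAction_mk_smul · HodgeCM.Model.LevelDeckTransfer.finiteDeckCover · HodgeCM.Model.LevelDeckTransfer.exists_trPull_one_eq_of_invariant_free) (`HOME/mc/pub-hodgecm-mc-binder-1-g17/stage64/HodgeCM/Model/LevelDeckTransfer.lean`, md5 262caa2e11f3, 341 lines);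
landed by the second packager p2 gen 14 (p2-g14) in gate run 64 as `HodgeCM/Model/LevelDeckTransfer.lean` (verbatim).
-/
/-
Copyright (c) 2026 the pub-hodgecm formalisation cell (harness21).  New file, not vendored.
Origin: session prover-pub-hodgecm-mc-binder-1-g17-0 (unit pub-hodgecm-mc-binder-1-g17, BINDER PROVER gen 17 of lineage mc-binder-1;
content lane (J-Liu-Θ), (J3) — the (iib-T) lever «the tower without (ii-b)», root 2 of 2), 2026-08-20.
-/
import Summits.HodgeConjecture.HodgeCM.Model.LevelPullInjective
import Summits.HodgeConjecture.HodgeCM.Model.TowerInjective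
import Literature.AlgebraicTopology.SingularHomology.FiniteDeckTransferPullback

/-!
# Deck-invariant classes on a normal level cover of the model descend — WITHOUT (ii-b)

`Model/TowerTransfer.lean` (#R117) proves `(∀ γ ∈ Δ.Γ, t_γ^* z = z) → ∃ y, t_1^* y = z` for `Δ'' ≤ Δ`, `Δ''.Γ ⊴ Δ.Γ`, by
transporting Hatcher's transfer for the vendored QUOTIENT-datum cover `N\𝔹 → X(ℂ)` (`levelDeckCover`) along `levelHomeo` (#R95);
the quotient datum is `modelQuotientDatum h₂`, i.e. the record `h₂ : SpecialCyclesAlgebraic`.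

Here the finite REGULAR covering is built DIRECTLY on the complex points of the model (no quotient datum, no (ii-b)):
`E := X_{Δ''}(ℂ)`, `B := X_Δ(ℂ)`, `proj := levelCover Δ Δ''(ℂ)` (a finite covering: `isFiniteCover_levelCover`, (ii-b)-free,
`Model/LevelTransferPush.lean`), deck group `G := Δ.Γ ⧸ Δ''.Γ` acting on `E` through the rational translates
`t_γ : X_{Δ''} ⟶ X_{Δ''}` (#R107 `transMor`; well defined on the quotient because `t_δ(ℂ) = id` for `δ ∈ Δ''.Γ`, transitive on
the fibres because the fibres of `unif_Δ` are the `Δ.Γ·ℂˣ`-orbits — the uniformisation datum's own field `unif_eq_unif_iff`).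
Then `p^*(τ^* w) = Σ_{g ∈ G} g^* w` (vendored `FiniteDeckCover.map_proj_transferMap`, [HatcherAT2002 §3.G p. 321]) and universal
coefficients give

* `exists_trPull_one_eq_of_invariant_free` — the statement of #R117 `exists_trPull_one_eq_of_invariant` minus `SpecialCyclesAlgebraic`.

Records used: the universe's `hHD hI hU h₃`, `hA` — those of the tower carrier; NOT `SpecialCyclesAlgebraic`.  Definitions: the deck
permutation / homomorphism / action and the `FiniteDeckCover` record (data over existing records, no `Prop`-valued definition);
0 records minted, nothing cited anew.  Nothing here is a claim of the manuscripts under adjudication.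
-/

noncomputable section

open scoped Matrix
open Matrix Function Set
open NumberField CategoryTheory
open Literature.AlgebraicGeometry.Motives
open Literature.AlgebraicGeometry.ShimuraVarieties
open Literature.AlgebraicGeometry.HodgeTheory
open Literature.AlgebraicTopology.SingularHomology
open Literature.NumberTheory.Automorphic
open Literature.NumberTheory.Automorphic.PicardCM
open Literature.NumberTheory.Transcendental (Arapura2012_Cor_15_4_6)

namespace HodgeCM.Model.LevelDeckTransfer

open HodgeCM.Model.LevelTranslate HodgeCM.Model.TowerLevel HodgeCM.Model.LevelPullInjective
open HodgeCM.Model.LevelCoveringTwist (mulVec_mem_cone)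

variable (hHD : exists_isReal_hodgeModel) (hI : hodgePQ_independent_of_hodgeModel)
  (hU : BallQuotientUniformisedDatum) (h₃ : CMAbelianVarietyRealised) (hA : Arapura2012_Cor_15_4_6)
variable {L : CMField} {ι₁ : L →+* ℂ} {V : HermSpace3 L ι₁} {Δ Δ'' : Level V}

/-! ## 1. Point-level facts about the uniformisation of `X_{Δ₁}` (anisotropic regime) -/

/-- For a normal sublevel `Δ''.Γ ⊴ Δ.Γ`, every `γ ∈ Δ.Γ` translates `X_{Δ''}` to itself. -/
theorem transCond_of_normal (hN : (Δ''.Γ.subgroupOf Δ.Γ).Normal) (hle : Δ'' ≤ Δ) {γ : GL (Fin 3) L} (hγ : γ ∈ Δ.Γ) :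
    TransCond γ Δ'' Δ'' :=
  TransCond.iff.mpr fun δ hδ ↦ by
    have h := hN.conj_mem ⟨δ, Level.Γ_mono hle hδ⟩ (Subgroup.mem_subgroupOf.mpr hδ) ⟨γ, hγ⟩
    exact Subgroup.mem_subgroupOf.mp h

/-- A rational isometry maps the cone of `X_{Δ₁}`'s datum into itself. -/
theorem glι_mulVec_mem_cone {Δ₁ : Level V} (h₁ : (pmsCode L ι₁ V Δ₁).IsAnisotropic) {γ : GL (Fin 3) L} (hγ : γ ∈ Urat V)
    {v : Fin 3 → ℂ} (hv : v ∈ (Var.ballDatum hU h₃ (pmsCode L ι₁ V Δ₁) h₁).cone) :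
    (glι ι₁ γ : Matrix (Fin 3) (Fin 3) ℂ) *ᵥ v ∈ (Var.ballDatum hU h₃ (pmsCode L ι₁ V Δ₁) h₁).cone :=
  mulVec_mem_cone rfl (map_ι₁_mem_realPoints hU h₃ hγ Δ₁ h₁) hv

/-- **`unif_{Δ₁} (δ v) = unif_{Δ₁} v` for `δ ∈ Δ₁.Γ`** (the fibres of `unif` are the `Γ·ℂˣ`-orbits; `Γ^{τ₁} = Δ₁.Γ^{ι₁}`). -/
theorem unif_glι_mulVec_of_mem {Δ₁ : Level V} (h₁ : (pmsCode L ι₁ V Δ₁).IsAnisotropic) {δ : GL (Fin 3) L} (hδ : δ ∈ Δ₁.Γ)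
    {v : Fin 3 → ℂ} (hv : v ∈ (Var.ballDatum hU h₃ (pmsCode L ι₁ V Δ₁) h₁).cone) :
    (Var.ballDatum hU h₃ (pmsCode L ι₁ V Δ₁) h₁).unif ((glι ι₁ δ : Matrix (Fin 3) (Fin 3) ℂ) *ᵥ v) =
      (Var.ballDatum hU h₃ (pmsCode L ι₁ V Δ₁) h₁).unif v := by
  set D := Var.ballDatum hU h₃ (pmsCode L ι₁ V Δ₁) h₁ with hD
  have hmem : glι ι₁ δ ∈ D.Γ.map (Matrix.GeneralLinearGroup.map D.τ₁) := by
    rw [hD, ballDatum_map_Γ hU h₃ Δ₁ h₁]; exact Subgroup.mem_map_of_mem _ hδ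
  obtain ⟨γ', hγ', he⟩ := Subgroup.mem_map.mp hmem
  have hgv := glι_mulVec_mem_cone hU h₃ h₁ (Δ₁.Γ_le_rational hδ) hv
  refine ((D.unif_eq_unif_iff v hv _ hgv).2 ⟨γ', hγ', 1, one_ne_zero, ?_⟩).symm
  rw [one_smul]
  have hmat := congrArg (fun g : GL (Fin 3) ℂ ↦ (g : Matrix (Fin 3) (Fin 3) ℂ)) he
  simp only [UnitaryBallUniformisationDatum.coe_generalLinearGroup_map] at hmat
  rw [hmat]

/-- **Same fibre of `unif_{Δ₁}` ⇒ translates of each other by `Δ₁.Γ`, up to `ℂˣ`.** -/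
theorem exists_mem_Γ_of_unif_eq {Δ₁ : Level V} (h₁ : (pmsCode L ι₁ V Δ₁).IsAnisotropic) {v w : Fin 3 → ℂ}
    (hv : v ∈ (Var.ballDatum hU h₃ (pmsCode L ι₁ V Δ₁) h₁).cone) (hw : w ∈ (Var.ballDatum hU h₃ (pmsCode L ι₁ V Δ₁) h₁).cone)
    (h : (Var.ballDatum hU h₃ (pmsCode L ι₁ V Δ₁) h₁).unif v = (Var.ballDatum hU h₃ (pmsCode L ι₁ V Δ₁) h₁).unif w) :
    ∃ γ ∈ Δ₁.Γ, ∃ c : ℂ, c ≠ 0 ∧ (glι ι₁ γ : Matrix (Fin 3) (Fin 3) ℂ) *ᵥ v = c • w := by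
  set D := Var.ballDatum hU h₃ (pmsCode L ι₁ V Δ₁) h₁ with hD
  obtain ⟨γ', hγ', c, hc, hγv⟩ := (D.unif_eq_unif_iff v hv w hw).1 h
  have hmem : Matrix.GeneralLinearGroup.map D.τ₁ γ' ∈ Δ₁.Γ.map (Matrix.GeneralLinearGroup.map ι₁) := by
    rw [← ballDatum_map_Γ hU h₃ Δ₁ h₁]; exact Subgroup.mem_map_of_mem _ hγ'
  obtain ⟨γ, hγ, he⟩ := Subgroup.mem_map.mp hmem
  refine ⟨γ, hγ, c, hc, ?_⟩
  have hmat := congrArg (fun g : GL (Fin 3) ℂ ↦ (g : Matrix (Fin 3) (Fin 3) ℂ)) he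
  simp only [UnitaryBallUniformisationDatum.coe_generalLinearGroup_map] at hmat
  change ((Matrix.GeneralLinearGroup.map ι₁ γ : GL (Fin 3) ℂ) : Matrix (Fin 3) (Fin 3) ℂ) *ᵥ v = c • w
  rw [hmat]
  exact hγv

/-! ## 2. The deck transformations of `X_{Δ''}(ℂ) → X_Δ(ℂ)`: the rational translates `t_γ(ℂ)`, `γ ∈ Δ.Γ` -/

section Deck

variable (hN : (Δ''.Γ.subgroupOf Δ.Γ).Normal) (hle : Δ'' ≤ Δ)

/-- The deck map of `γ ∈ Δ.Γ` on `X_{Δ''}(ℂ)`: the complex points of the translate `t_γ : X_{Δ''} ⟶ X_{Δ''}`. -/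
def deckMap (γ : ↥Δ.Γ) :
    ComplexPoints (Var.scheme hU h₃ (.pms (pmsCode L ι₁ V Δ''))) → ComplexPoints (Var.scheme hU h₃ (.pms (pmsCode L ι₁ V Δ''))) :=
  AlgPoints.map (transMor hU h₃ hHD hA (Δ.Γ_le_rational γ.2) Δ'' Δ'' (transCond_of_normal hN hle γ.2))

/-- (Ported verbatim from the HodgeCMPerL package; no docstring in the source.) -/
theorem deckMap_apply (γ : ↥Δ.Γ) (P : ComplexPoints (Var.scheme hU h₃ (.pms (pmsCode L ι₁ V Δ'')))) :
    deckMap hHD hU h₃ hA hN hle γ P =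
      AlgPoints.map (transMor hU h₃ hHD hA (Δ.Γ_le_rational γ.2) Δ'' Δ'' (transCond_of_normal hN hle γ.2)) P := rfl

/-- (Ported verbatim from the HodgeCMPerL package; no docstring in the source.) -/
theorem continuous_deckMap (γ : ↥Δ.Γ) : Continuous (deckMap hHD hU h₃ hA hN hle γ) :=
  (AlgPoints.mapContinuous (L := ℂ)
    (transMor hU h₃ hHD hA (Δ.Γ_le_rational γ.2) Δ'' Δ'' (transCond_of_normal hN hle γ.2))).continuous

/-- `t_γ(ℂ) (unif'' v) = unif'' (γ v)` (regime). -/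
theorem deckMap_unif (hV : IsAnisotropic L V.Hm) (γ : ↥Δ.Γ) {v : Fin 3 → ℂ}
    (hv : v ∈ (Var.ballDatum hU h₃ (pmsCode L ι₁ V Δ'') ((isAnisotropic_pmsCode_iff L ι₁ V Δ'').2 hV)).cone) :
    deckMap hHD hU h₃ hA hN hle γ ((Var.ballDatum hU h₃ (pmsCode L ι₁ V Δ'') ((isAnisotropic_pmsCode_iff L ι₁ V Δ'').2 hV)).unif v) =
      (Var.ballDatum hU h₃ (pmsCode L ι₁ V Δ'') ((isAnisotropic_pmsCode_iff L ι₁ V Δ'').2 hV)).unif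
        ((glι ι₁ (γ : GL (Fin 3) L) : Matrix (Fin 3) (Fin 3) ℂ) *ᵥ v) :=
  map_transMor_unif hU h₃ hHD hA _ _ hV hv

/-- `t_1(ℂ) = id` on `X_{Δ''}(ℂ)`. -/
theorem deckMap_one (P : ComplexPoints (Var.scheme hU h₃ (.pms (pmsCode L ι₁ V Δ'')))) :
    deckMap hHD hU h₃ hA hN hle 1 P = P := by
  by_cases hV : IsAnisotropic L V.Hm
  · obtain ⟨v, hv, rfl⟩ := (Var.ballDatum hU h₃ (pmsCode L ι₁ V Δ'') ((isAnisotropic_pmsCode_iff L ι₁ V Δ'').2 hV)).surjOn_unif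
      (mem_univ P)
    rw [deckMap_unif hHD hU h₃ hA hN hle hV 1 hv]
    simp only [OneMemClass.coe_one, glι, map_one, Units.val_one, one_mulVec]
  · rw [deckMap_apply]
    unfold transMor
    rw [dif_neg hV]
    simp only [eqToHom_refl, AlgPoints.map_id_apply]

/-- `t_{γ₁ γ₂}(ℂ) = t_{γ₁}(ℂ) ∘ t_{γ₂}(ℂ)` on `X_{Δ''}(ℂ)`. -/
theorem deckMap_mul (γ₁ γ₂ : ↥Δ.Γ) (P : ComplexPoints (Var.scheme hU h₃ (.pms (pmsCode L ι₁ V Δ'')))) :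
    deckMap hHD hU h₃ hA hN hle (γ₁ * γ₂) P = deckMap hHD hU h₃ hA hN hle γ₁ (deckMap hHD hU h₃ hA hN hle γ₂ P) := by
  by_cases hV : IsAnisotropic L V.Hm
  · obtain ⟨v, hv, rfl⟩ := (Var.ballDatum hU h₃ (pmsCode L ι₁ V Δ'') ((isAnisotropic_pmsCode_iff L ι₁ V Δ'').2 hV)).surjOn_unif
      (mem_univ P)
    have hv₂ := glι_mulVec_mem_cone hU h₃ ((isAnisotropic_pmsCode_iff L ι₁ V Δ'').2 hV) (Δ.Γ_le_rational γ₂.2) hv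
    rw [deckMap_unif hHD hU h₃ hA hN hle hV _ hv, deckMap_unif hHD hU h₃ hA hN hle hV _ hv,
      deckMap_unif hHD hU h₃ hA hN hle hV _ hv₂, mulVec_mulVec]
    simp only [Subgroup.coe_mul, glι, map_mul, Units.val_mul]
  · simp only [deckMap_apply]
    unfold transMor
    simp only [dif_neg hV, eqToHom_refl, AlgPoints.map_id_apply]

/-- `t_δ(ℂ) = id` on `X_{Δ''}(ℂ)` for `δ ∈ Δ''.Γ`. -/
theorem deckMap_of_mem {δ : ↥Δ.Γ} (hδ : (δ : GL (Fin 3) L) ∈ Δ''.Γ)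
    (P : ComplexPoints (Var.scheme hU h₃ (.pms (pmsCode L ι₁ V Δ'')))) :
    deckMap hHD hU h₃ hA hN hle δ P = P := by
  by_cases hV : IsAnisotropic L V.Hm
  · obtain ⟨v, hv, rfl⟩ := (Var.ballDatum hU h₃ (pmsCode L ι₁ V Δ'') ((isAnisotropic_pmsCode_iff L ι₁ V Δ'').2 hV)).surjOn_unif
      (mem_univ P)
    rw [deckMap_unif hHD hU h₃ hA hN hle hV δ hv, unif_glι_mulVec_of_mem hU h₃ _ hδ hv]
  · rw [deckMap_apply]
    unfold transMor
    rw [dif_neg hV]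
    simp only [eqToHom_refl, AlgPoints.map_id_apply]

/-- The deck map of `γ ∈ Δ.Γ` as a permutation of `X_{Δ''}(ℂ)` (inverse: the deck map of `γ⁻¹`). -/
def deckPerm (γ : ↥Δ.Γ) : Equiv.Perm (ComplexPoints (Var.scheme hU h₃ (.pms (pmsCode L ι₁ V Δ'')))) where
  toFun := deckMap hHD hU h₃ hA hN hle γ
  invFun := deckMap hHD hU h₃ hA hN hle γ⁻¹
  left_inv P := by rw [← deckMap_mul, inv_mul_cancel, deckMap_one]
  right_inv P := by rw [← deckMap_mul, mul_inv_cancel, deckMap_one]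

/-- `γ ↦ t_γ(ℂ)` is a homomorphism `Δ.Γ →* Perm X_{Δ''}(ℂ)`. -/
def deckHom : ↥Δ.Γ →* Equiv.Perm (ComplexPoints (Var.scheme hU h₃ (.pms (pmsCode L ι₁ V Δ'')))) where
  toFun := deckPerm hHD hU h₃ hA hN hle
  map_one' := Equiv.ext fun P ↦ deckMap_one hHD hU h₃ hA hN hle P
  map_mul' γ₁ γ₂ := Equiv.ext fun P ↦ deckMap_mul hHD hU h₃ hA hN hle γ₁ γ₂ P

/-- (Ported verbatim from the HodgeCMPerL package; no docstring in the source.) -/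
theorem deckHom_apply (γ : ↥Δ.Γ) (P : ComplexPoints (Var.scheme hU h₃ (.pms (pmsCode L ι₁ V Δ'')))) :
    deckHom hHD hU h₃ hA hN hle γ P = deckMap hHD hU h₃ hA hN hle γ P := rfl

/-- `Δ''.Γ` acts trivially: the homomorphism factors through `Δ.Γ ⧸ Δ''.Γ`. -/
theorem subgroupOf_le_ker : Δ''.Γ.subgroupOf Δ.Γ ≤ (deckHom hHD hU h₃ hA hN hle).ker := fun δ hδ ↦ by
  rw [MonoidHom.mem_ker]
  exact Equiv.ext fun P ↦ deckMap_of_mem hHD hU h₃ hA hN hle (Subgroup.mem_subgroupOf.mp hδ) P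

/-- The deck homomorphism of the finite group `Δ.Γ ⧸ Δ''.Γ`. -/
def deckHomQuot : haveI := hN; ↥Δ.Γ ⧸ Δ''.Γ.subgroupOf Δ.Γ →* Equiv.Perm (ComplexPoints (Var.scheme hU h₃ (.pms (pmsCode L ι₁ V Δ'')))) :=
  haveI := hN
  QuotientGroup.lift _ (deckHom hHD hU h₃ hA hN hle) (subgroupOf_le_ker hHD hU h₃ hA hN hle)

/-- (Ported verbatim from the HodgeCMPerL package; no docstring in the source.) -/
theorem deckHomQuot_mk (γ : ↥Δ.Γ) :
    haveI := hN; deckHomQuot hHD hU h₃ hA hN hle (QuotientGroup.mk γ) = deckPerm hHD hU h₃ hA hN hle γ := by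
  haveI := hN
  exact QuotientGroup.lift_mk _ _ γ

/-- The deck ACTION of `Δ.Γ ⧸ Δ''.Γ` on `X_{Δ''}(ℂ)` (a reducible `def`, installed locally with `letI`). -/
@[reducible] def deckAction : haveI := hN; MulAction (↥Δ.Γ ⧸ Δ''.Γ.subgroupOf Δ.Γ) (ComplexPoints (Var.scheme hU h₃ (.pms (pmsCode L ι₁ V Δ'')))) :=
  haveI := hN
  MulAction.compHom _ (deckHomQuot hHD hU h₃ hA hN hle)

/-- (Ported verbatim from the HodgeCMPerL package; no docstring in the source.) -/
theorem deckAction_mk_smul (γ : ↥Δ.Γ) (P : ComplexPoints (Var.scheme hU h₃ (.pms (pmsCode L ι₁ V Δ'')))) :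
    haveI := hN; letI := deckAction hHD hU h₃ hA hN hle;
      (QuotientGroup.mk γ : ↥Δ.Γ ⧸ Δ''.Γ.subgroupOf Δ.Γ) • P = deckMap hHD hU h₃ hA hN hle γ P := by
  haveI := hN
  letI := deckAction hHD hU h₃ hA hN hle
  change deckHomQuot hHD hU h₃ hA hN hle (QuotientGroup.mk γ) P = _
  rw [deckHomQuot_mk]
  rfl

/-! ## 3. The finite regular covering `X_{Δ''}(ℂ) → X_Δ(ℂ)` -/

/-- **The level covering `X_{Δ''}(ℂ) → X_Δ(ℂ)` with deck group `Δ.Γ ⧸ Δ''.Γ` is a finite regular covering** (`Δ''.Γ ⊴ Δ.Γ`):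
covering map, onto, deck maps continuous over the base, transitive on the fibres. [cite: HatcherAT2002, §1.3 Prop. 1.39] -/
def finiteDeckCover [Fintype (↥Δ.Γ ⧸ Δ''.Γ.subgroupOf Δ.Γ)] :
    haveI := hN; letI := deckAction hHD hU h₃ hA hN hle;
    FiniteDeckCover (↥Δ.Γ ⧸ Δ''.Γ.subgroupOf Δ.Γ) (ComplexPoints (Var.scheme hU h₃ (.pms (pmsCode L ι₁ V Δ''))))
      (ComplexPoints (Var.scheme hU h₃ (.pms (pmsCode L ι₁ V Δ)))) := by
  haveI := hN
  letI := deckAction hHD hU h₃ hA hN hle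
  exact
  { proj := AlgPoints.mapContinuous (L := ℂ) (levelCover hU h₃ hHD hA Δ Δ'' (Level.Γ_mono hle))
    isCoveringMap_proj := (isFiniteCover_levelCover hU h₃ hHD hA Δ Δ'' (Level.Γ_mono hle)).isCoveringMap
    surjective_proj := (isFiniteCover_levelCover hU h₃ hHD hA Δ Δ'' (Level.Γ_mono hle)).surjective
    continuous_smul := fun q ↦ by
      induction q using QuotientGroup.induction_on with
      | H γ =>
        have e : (fun P : ComplexPoints (Var.scheme hU h₃ (.pms (pmsCode L ι₁ V Δ''))) ↦
            (QuotientGroup.mk γ : ↥Δ.Γ ⧸ Δ''.Γ.subgroupOf Δ.Γ) • P) = deckMap hHD hU h₃ hA hN hle γ :=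
          funext fun P ↦ deckAction_mk_smul hHD hU h₃ hA hN hle γ P
        rw [e]
        exact continuous_deckMap hHD hU h₃ hA hN hle γ
    proj_smul := fun q P ↦ by
      induction q using QuotientGroup.induction_on with
      | H γ =>
        rw [deckAction_mk_smul, AlgPoints.mapContinuous_apply, AlgPoints.mapContinuous_apply]
        by_cases hV : IsAnisotropic L V.Hm
        · obtain ⟨v, hv, rfl⟩ :=
            (Var.ballDatum hU h₃ (pmsCode L ι₁ V Δ'') ((isAnisotropic_pmsCode_iff L ι₁ V Δ'').2 hV)).surjOn_unif (mem_univ P)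
          have hv₂ := glι_mulVec_mem_cone hU h₃ ((isAnisotropic_pmsCode_iff L ι₁ V Δ'').2 hV) (Δ.Γ_le_rational γ.2) hv
          rw [deckMap_unif hHD hU h₃ hA hN hle hV γ hv, map_levelCover_unif hU h₃ hHD hA _ hV hv₂,
            map_levelCover_unif hU h₃ hHD hA _ hV hv]
          have hv' : v ∈ (Var.ballDatum hU h₃ (pmsCode L ι₁ V Δ) ((isAnisotropic_pmsCode_iff L ι₁ V Δ).2 hV)).cone := by
            have hH := ballDatum_Hℂ_eq hU h₃ Δ Δ'' ((isAnisotropic_pmsCode_iff L ι₁ V Δ'').2 hV)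
              ((isAnisotropic_pmsCode_iff L ι₁ V Δ).2 hV)
            change v ∈ negCone _; rw [← hH]; exact hv
          exact unif_glι_mulVec_of_mem hU h₃ _ γ.2 hv'
        · rw [deckMap_apply]
          unfold transMor
          rw [dif_neg hV]
          simp only [eqToHom_refl, AlgPoints.map_id_apply]
    exists_smul_of_proj_eq := fun {P P'} h ↦ by
      rw [AlgPoints.mapContinuous_apply, AlgPoints.mapContinuous_apply] at h
      by_cases hV : IsAnisotropic L V.Hm
      · obtain ⟨v, hv, rfl⟩ :=
          (Var.ballDatum hU h₃ (pmsCode L ι₁ V Δ'') ((isAnisotropic_pmsCode_iff L ι₁ V Δ'').2 hV)).surjOn_unif (mem_univ P)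
        obtain ⟨v', hv', rfl⟩ :=
          (Var.ballDatum hU h₃ (pmsCode L ι₁ V Δ'') ((isAnisotropic_pmsCode_iff L ι₁ V Δ'').2 hV)).surjOn_unif (mem_univ P')
        rw [map_levelCover_unif hU h₃ hHD hA _ hV hv', map_levelCover_unif hU h₃ hHD hA _ hV hv] at h
        -- `unif_Δ v' = unif_Δ v` ⇒ `γ v = c • v'` for some `γ ∈ Δ.Γ`, `c ≠ 0`
        have hH := ballDatum_Hℂ_eq hU h₃ Δ Δ'' ((isAnisotropic_pmsCode_iff L ι₁ V Δ'').2 hV)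
          ((isAnisotropic_pmsCode_iff L ι₁ V Δ).2 hV)
        have hvΔ : v ∈ (Var.ballDatum hU h₃ (pmsCode L ι₁ V Δ) ((isAnisotropic_pmsCode_iff L ι₁ V Δ).2 hV)).cone := by
          change v ∈ negCone _; rw [← hH]; exact hv
        have hv'Δ : v' ∈ (Var.ballDatum hU h₃ (pmsCode L ι₁ V Δ) ((isAnisotropic_pmsCode_iff L ι₁ V Δ).2 hV)).cone := by
          change v' ∈ negCone _; rw [← hH]; exact hv'
        obtain ⟨γ, hγ, c, hc, hγv⟩ := exists_mem_Γ_of_unif_eq hU h₃ _ hvΔ hv'Δ h.symm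
        refine ⟨QuotientGroup.mk ⟨γ, hγ⟩, ?_⟩
        rw [deckAction_mk_smul, deckMap_unif hHD hU h₃ hA hN hle hV ⟨γ, hγ⟩ hv]
        change _ = (Var.ballDatum hU h₃ (pmsCode L ι₁ V Δ'') _).unif ((glι ι₁ γ : Matrix (Fin 3) (Fin 3) ℂ) *ᵥ v)
        rw [hγv, UnitaryBallUniformisationDatum.unif_smul _ hc hv']
      · -- off the regime the covering is the identity of `ℙ²(ℂ)`: `P' = P`, the unit acts
        refine ⟨1, ?_⟩
        rw [one_smul]
        obtain ⟨e, he⟩ := levelCover_eq_eqToHom_of_not_isAnisotropic hU h₃ hHD hA Δ Δ'' (Level.Γ_mono hle) hV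
        rw [he] at h
        have h' := congrArg (AlgPoints.map (eqToHom e.symm)) h
        simp only [← AlgPoints.map_comp_apply, eqToHom_trans, eqToHom_refl, AlgPoints.map_id_apply] at h'
        exact h' }

end Deck

/-! ## 4. Deck-invariant classes descend, (ii-b)-free -/

/-- **Deck-invariant classes descend** (normal sublevel `Δ''.Γ ⊴ Δ.Γ`): if `t_γ^* z = z` for every `γ ∈ Δ.Γ` then `z = t_1^* y` for
some `y ∈ Hᵏ(X_Δ(ℂ);ℚ)_ℂ`.  Same statement as #R117 `TowerTransfer.exists_trPull_one_eq_of_invariant` minus the hypothesis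
`SpecialCyclesAlgebraic`. [cite: HatcherAT2002, §3.G p. 321] -/
theorem exists_trPull_one_eq_of_invariant_free (hle : Δ'' ≤ Δ) (hN : (Δ''.Γ.subgroupOf Δ.Γ).Normal)
    (ht : TransCond ((1 : ↥(Urat V)) : GL (Fin 3) L) Δ'' Δ) (k : ℕ) (z : Coh hHD hI hU h₃ Δ'' k)
    (hz : ∀ (γ : GL (Fin 3) L) (hγ : γ ∈ Δ.Γ),
      trPull hHD hI hU h₃ hA ⟨γ, Δ.Γ_le_rational hγ⟩ Δ'' Δ'' (transCond_of_normal hN hle hγ) k z = z) :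
    ∃ y : Coh hHD hI hU h₃ Δ k, trPull hHD hI hU h₃ hA 1 Δ'' Δ ht k y = z := by
  haveI := hN
  haveI : (Δ''.Γ.subgroupOf Δ.Γ).FiniteIndex := Level.finiteIndex_subgroupOf Δ Δ''
  haveI : Fintype (↥Δ.Γ ⧸ Δ''.Γ.subgroupOf Δ.Γ) := Subgroup.fintypeQuotientOfFiniteIndex
  letI := deckAction hHD hU h₃ hA hN hle
  set cov := finiteDeckCover hHD hU h₃ hA hN hle with hcovdef
  -- the complexified class upstairs
  set zc := ofRatClassBaseChange (ComplexPoints (Var.scheme hU h₃ (.pms (pmsCode L ι₁ V Δ'')))) k z with hzc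
  -- deck invariance of `zc`
  have hinv : ∀ q : ↥Δ.Γ ⧸ Δ''.Γ.subgroupOf Δ.Γ, singularCohomology.map ℂ ℂ (cov.deck q) k zc = zc := by
    intro q
    induction q using QuotientGroup.induction_on with
    | H γ =>
    set t := transMor hU h₃ hHD hA (Δ.Γ_le_rational γ.2) Δ'' Δ'' (transCond_of_normal hN hle γ.2) with htdef
    have hdeck : cov.deck (QuotientGroup.mk γ) = AlgPoints.mapContinuous (L := ℂ) t := by
      refine ContinuousMap.ext fun P ↦ ?_
      rw [FiniteDeckCover.deck_apply, AlgPoints.mapContinuous_apply]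
      exact deckAction_mk_smul hHD hU h₃ hA hN hle γ P
    rw [hdeck, hzc, map_ofRatClassBaseChange]
    have : (BettiUniverse.pull t k).baseChange ℂ z = z := hz γ.1 γ.2
    change ofRatClassBaseChange _ k ((BettiUniverse.pull t k).baseChange ℂ z) = _
    rw [this]
  -- transfer: `p^*(τ zc) = |G| • zc`
  have htr := cov.map_proj_transferMap (R := ℂ) k zc
  simp only [hinv, Finset.sum_const, Finset.card_univ] at htr
  set u := ((Fintype.card (↥Δ.Γ ⧸ Δ''.Γ.subgroupOf Δ.Γ) : ℂ)⁻¹) • cov.transferMap (R := ℂ) k zc with hu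
  have hcard : (Fintype.card (↥Δ.Γ ⧸ Δ''.Γ.subgroupOf Δ.Γ) : ℂ) ≠ 0 := Nat.cast_ne_zero.2 Fintype.card_ne_zero
  have hpu : singularCohomology.map ℂ ℂ cov.proj k u = zc := by
    rw [hu, map_smul, htr, ← Nat.cast_smul_eq_nsmul ℂ, smul_smul, inv_mul_cancel₀ hcard, one_smul]
  -- `u` is a complexified rational class downstairs
  obtain ⟨u', hu'⟩ := ofRatClassBaseChange_surjective (Var.isSmoothProjective hU h₃ (.pms (pmsCode L ι₁ V Δ))) k u
  refine ⟨u', ?_⟩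
  have hle' : Δ''.Γ ≤ Δ.Γ := Level.Γ_mono hle
  have key : ofRatClassBaseChange (ComplexPoints (Var.scheme hU h₃ (.pms (pmsCode L ι₁ V Δ'')))) k
      (trPull hHD hI hU h₃ hA 1 Δ'' Δ ht k u') = singularCohomology.map ℂ ℂ cov.proj k u := by
    rw [← hu', show cov.proj = AlgPoints.mapContinuous (L := ℂ) (levelCover hU h₃ hHD hA Δ Δ'' hle') from rfl,
      map_ofRatClassBaseChange]
    congr 1
    change ((BettiUniverse.pull (transMor hU h₃ hHD hA (Subgroup.one_mem (Urat V)) Δ'' Δ ht) k).baseChange ℂ) u' =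
      ((BettiUniverse.pull (levelCover hU h₃ hHD hA Δ Δ'' hle') k).baseChange ℂ) u'
    rw [pull_levelCover_eq hU h₃ hHD hA hle' k]
  apply ofRatClassBaseChange_injective (ComplexPoints (Var.scheme hU h₃ (.pms (pmsCode L ι₁ V Δ'')))) k
  rw [key, hpu]

end HodgeCM.Model.LevelDeckTransfer

end
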